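import Summits.HubbardSuperconductivity.HubbardSuperconductivity.Theorems.BalabanIRBirComplexStableXYRLogConcaveCore
import HarnessLib

/-!
# The log-concave envelope of the modulus weight: window penalty and Hessian floor

Support file for crux `BirComplexStableXYR` (stmt-HubbardSuperconductivity-14845) of route
`BalabanIR`, idea card `log-concave-core-bounded-phase`.

`convexityRadius` (file `…RConvexityRadius`) makes `Re F` convex, with Hessian floor
`(c₀/4)·ΣΣ(v_w − v_w')²`, on window configurations of oscillation `≤ δ₀(r,B,c₀)`; outside that
radius nothing is claimed.  To run Brascamp–Lieb (a whole-space theorem) we build a `C²` convex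
PENALTY that vanishes exactly on the `ℓ²`-core `{ΣΣ(φ_w − φ_w')² ≤ a}` (`2a = δ₀²`) and restores
the floor outside it:

* `p(y) = (max y 0)³` is `C²` with `p' = 3(max y 0)²`, `p'' = 6 max y 0` (`pen_*`);
* along a line `t ↦ φ + tψ` the window penalty `p(ΣΣ((φ+tψ)_w − (φ+tψ)_w')² − a)` has explicit
  first and second derivatives (`win_pen_*`), the second being `≥ 0` always and
  `≥ 6a²·ΣΣ(ψ_w − ψ_w')²` once the window has left the `2a`-core;
* the real window Hessian is bounded by `2·normA(c)·ΣΣ(ψ_w − ψ_w')²` in absolute value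
  (`win_abs_reHess_le`), so for `k·6a² ≥ 2 max(B,0) + c₀/4` the penalised window Hessian has the
  floor `(c₀/4)·ΣΣ(ψ_w − ψ_w')²` EVERYWHERE (`win_floor`).

No new definitions; fully proved, standard axioms.
-/

noncomputable section

namespace Summit.HubbardSuperconductivity.HubbardSuperconductivity.Theorems

namespace CorePenalty

open scoped BigOperators Topology
open Filter Summit.HubbardSuperconductivity.BirComplexStableXYNegative

/-! ### The one-dimensional penalty `p(y) = (max y 0)³` -/

/-- `p(y) = (max y 0)³` has derivative `3 (max y 0)²`. [folklore] -/
theorem pen_hasDerivAt_cube (y : ℝ) :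
    HasDerivAt (fun y : ℝ => (max y 0) ^ 3) (3 * (max y 0) ^ 2) y := by
  rcases lt_trichotomy y 0 with hy | hy | hy
  · have hev : (fun z : ℝ => (max z 0) ^ 3) =ᶠ[𝓝 y] fun _ => (0 : ℝ) := by
      filter_upwards [Iio_mem_nhds hy] with z hz
      rw [max_eq_right (le_of_lt hz)]; norm_num
    rw [max_eq_right hy.le]
    simpa using (hasDerivAt_const y (0 : ℝ)).congr_of_eventuallyEq hev
  · subst hy
    rw [show (3 : ℝ) * (max (0 : ℝ) 0) ^ 2 = 0 by simp, hasDerivAt_iff_isLittleO]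
    refine Asymptotics.isLittleO_iff.2 fun c hc => ?_
    filter_upwards [Metric.ball_mem_nhds (0 : ℝ) (lt_min one_pos hc)] with h hh
    rw [Metric.mem_ball, dist_zero_right, Real.norm_eq_abs, lt_min_iff] at hh
    have h0 : 0 ≤ max h 0 := le_max_right _ _
    have h1 : max h 0 ≤ |h| := max_le (le_abs_self h) (abs_nonneg h)
    have h2 : (max h 0) ^ 3 ≤ |h| ^ 3 := pow_le_pow_left₀ h0 h1 3
    have h3 : |h| ^ 3 ≤ c * |h| := by
      have : |h| ^ 2 ≤ c := by nlinarith [abs_nonneg h]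
      nlinarith [abs_nonneg h]
    have e : (max h 0) ^ 3 - (max 0 0) ^ 3 - (h - 0) • (0 : ℝ) = (max h 0) ^ 3 := by simp
    show ‖(max h 0) ^ 3 - (max 0 0) ^ 3 - (h - 0) • (0 : ℝ)‖ ≤ c * ‖h - 0‖
    rw [e, sub_zero, Real.norm_eq_abs, Real.norm_eq_abs, abs_of_nonneg (pow_nonneg h0 3)]
    exact h2.trans h3
  · have hev : (fun z : ℝ => (max z 0) ^ 3) =ᶠ[𝓝 y] fun z => z ^ 3 := by
      filter_upwards [Ioi_mem_nhds hy] with z hz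
      rw [max_eq_left (le_of_lt hz)]
    rw [max_eq_left hy.le]
    have h := (hasDerivAt_pow 3 y).congr_of_eventuallyEq hev
    exact h.congr_deriv (by norm_num)

/-- `3 (max y 0)²` has derivative `6 max y 0`. [folklore] -/
theorem pen_hasDerivAt_sq (y : ℝ) :
    HasDerivAt (fun y : ℝ => 3 * (max y 0) ^ 2) (6 * max y 0) y := by
  suffices h : HasDerivAt (fun y : ℝ => (max y 0) ^ 2) (2 * max y 0) y by
    exact (h.const_mul 3).congr_deriv (by ring)
  rcases lt_trichotomy y 0 with hy | hy | hy
  · have hev : (fun z : ℝ => (max z 0) ^ 2) =ᶠ[𝓝 y] fun _ => (0 : ℝ) := by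
      filter_upwards [Iio_mem_nhds hy] with z hz
      rw [max_eq_right (le_of_lt hz)]; norm_num
    rw [max_eq_right hy.le]
    simpa using (hasDerivAt_const y (0 : ℝ)).congr_of_eventuallyEq hev
  · subst hy
    rw [show (2 : ℝ) * max (0 : ℝ) 0 = 0 by simp, hasDerivAt_iff_isLittleO]
    refine Asymptotics.isLittleO_iff.2 fun c hc => ?_
    filter_upwards [Metric.ball_mem_nhds (0 : ℝ) hc] with h hh
    rw [Metric.mem_ball, dist_zero_right, Real.norm_eq_abs] at hh
    have h0 : 0 ≤ max h 0 := le_max_right _ _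
    have h1 : max h 0 ≤ |h| := max_le (le_abs_self h) (abs_nonneg h)
    have h2 : (max h 0) ^ 2 ≤ |h| ^ 2 := pow_le_pow_left₀ h0 h1 2
    have h3 : |h| ^ 2 ≤ c * |h| := by nlinarith [abs_nonneg h]
    have e : (max h 0) ^ 2 - (max 0 0) ^ 2 - (h - 0) • (0 : ℝ) = (max h 0) ^ 2 := by simp
    show ‖(max h 0) ^ 2 - (max 0 0) ^ 2 - (h - 0) • (0 : ℝ)‖ ≤ c * ‖h - 0‖
    rw [e, sub_zero, Real.norm_eq_abs, Real.norm_eq_abs, abs_of_nonneg (pow_nonneg h0 2)]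
    exact h2.trans h3
  · have hev : (fun z : ℝ => (max z 0) ^ 2) =ᶠ[𝓝 y] fun z => z ^ 2 := by
      filter_upwards [Ioi_mem_nhds hy] with z hz
      rw [max_eq_left (le_of_lt hz)]
    rw [max_eq_left hy.le]
    have h := (hasDerivAt_pow 2 y).congr_of_eventuallyEq hev
    exact h.congr_deriv (by norm_num)

/-- `p(y) = (max y 0)³` is twice continuously differentiable. [folklore] -/
theorem pen_contDiff : ContDiff ℝ 2 (fun y : ℝ => (max y 0) ^ 3) := by
  have h1 : deriv (fun y : ℝ => (max y 0) ^ 3) = fun y => 3 * (max y 0) ^ 2 :=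
    funext fun y => (pen_hasDerivAt_cube y).deriv
  have h2 : deriv (fun y : ℝ => 3 * (max y 0) ^ 2) = fun y => 6 * max y 0 :=
    funext fun y => (pen_hasDerivAt_sq y).deriv
  rw [show (2 : WithTop ℕ∞) = 1 + 1 from rfl, contDiff_succ_iff_deriv]
  refine ⟨fun y => (pen_hasDerivAt_cube y).differentiableAt, fun h => ?_, ?_⟩
  · exact absurd h (by decide)
  rw [h1, contDiff_one_iff_deriv]
  refine ⟨fun y => (pen_hasDerivAt_sq y).differentiableAt, ?_⟩
  rw [h2]
  exact (continuous_id.max continuous_const).const_smul (6 : ℝ)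

/-- `p ≥ 0`. [folklore] -/
theorem pen_nonneg (y : ℝ) : 0 ≤ (max y 0) ^ 3 := pow_nonneg (le_max_right _ _) 3

/-- `p(y) = 0` for `y ≤ 0`. [folklore] -/
theorem pen_eq_zero {y : ℝ} (hy : y ≤ 0) : (max y 0) ^ 3 = 0 := by
  rw [max_eq_right hy]; norm_num

/-- `p(y) > 0` for `y > 0`. [folklore] -/
theorem pen_pos {y : ℝ} (hy : 0 < y) : 0 < (max y 0) ^ 3 := by
  rw [max_eq_left hy.le]; positivity

/-! ### The window Dirichlet form along a line -/

variable {r : ℕ}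

/-- `d/dt ΣΣ((φ+tψ)_w − (φ+tψ)_w')² = ΣΣ 2((φ+tψ)_w − (φ+tψ)_w')(ψ_w − ψ_w')`. [folklore] -/
theorem win_dir_hasDerivAt (φ ψ : W r → ℝ) (t : ℝ) :
    HasDerivAt (fun s : ℝ => ∑ w, ∑ w', ((φ w + s * ψ w) - (φ w' + s * ψ w')) ^ 2)
      (∑ w, ∑ w', 2 * ((φ w + t * ψ w) - (φ w' + t * ψ w')) * (ψ w - ψ w')) t := by
  refine HasDerivAt.fun_sum fun w _ => HasDerivAt.fun_sum fun w' _ => ?_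
  have h1 : HasDerivAt (fun s : ℝ => φ w + s * ψ w) (ψ w) t := by
    simpa using ((hasDerivAt_id t).mul_const (ψ w)).const_add (φ w)
  have h2 : HasDerivAt (fun s : ℝ => φ w' + s * ψ w') (ψ w') t := by
    simpa using ((hasDerivAt_id t).mul_const (ψ w')).const_add (φ w')
  have hl : HasDerivAt (fun s : ℝ => (φ w + s * ψ w) - (φ w' + s * ψ w')) (ψ w - ψ w') t :=
    h1.fun_sub h2
  exact (hl.fun_pow 2).congr_deriv (by push_cast; ring)

/-- `d/dt ΣΣ 2((φ+tψ)_w − (φ+tψ)_w')(ψ_w − ψ_w') = ΣΣ 2(ψ_w − ψ_w')²`. [folklore] -/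
theorem win_ddir_hasDerivAt (φ ψ : W r → ℝ) (t : ℝ) :
    HasDerivAt (fun s : ℝ => ∑ w, ∑ w', 2 * ((φ w + s * ψ w) - (φ w' + s * ψ w')) * (ψ w - ψ w'))
      (∑ w, ∑ w', 2 * (ψ w - ψ w') ^ 2) t := by
  refine HasDerivAt.fun_sum fun w _ => HasDerivAt.fun_sum fun w' _ => ?_
  have h1 : HasDerivAt (fun s : ℝ => φ w + s * ψ w) (ψ w) t := by
    simpa using ((hasDerivAt_id t).mul_const (ψ w)).const_add (φ w)
  have h2 : HasDerivAt (fun s : ℝ => φ w' + s * ψ w') (ψ w') t := by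
    simpa using ((hasDerivAt_id t).mul_const (ψ w')).const_add (φ w')
  have hl : HasDerivAt (fun s : ℝ => (φ w + s * ψ w) - (φ w' + s * ψ w')) (ψ w - ψ w') t :=
    h1.fun_sub h2
  have h3 : HasDerivAt (fun s : ℝ => 2 * ((φ w + s * ψ w) - (φ w' + s * ψ w')))
      (2 * (ψ w - ψ w')) t := hl.const_mul 2
  exact (h3.mul_const (ψ w - ψ w')).congr_deriv (by ring)

/-! ### The window penalty along a line -/

/-- First derivative of the window penalty along a line:
`d/dt p(Q(t) − a) = 3 (max (Q(t) − a) 0)² · Q'(t)`, `Q(t) = ΣΣ((φ+tψ)_w − (φ+tψ)_w')²`. [folklore] -/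
theorem win_pen_hasDerivAt (φ ψ : W r → ℝ) (a t : ℝ) :
    HasDerivAt (fun s : ℝ => (max ((∑ w, ∑ w', ((φ w + s * ψ w) - (φ w' + s * ψ w')) ^ 2) - a) 0) ^ 3)
      (3 * (max ((∑ w, ∑ w', ((φ w + t * ψ w) - (φ w' + t * ψ w')) ^ 2) - a) 0) ^ 2 *
        ∑ w, ∑ w', 2 * ((φ w + t * ψ w) - (φ w' + t * ψ w')) * (ψ w - ψ w')) t := by
  have hQ := (win_dir_hasDerivAt φ ψ t).sub_const a
  exact (pen_hasDerivAt_cube _).comp t hQ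

/-- Second derivative of the window penalty along a line:
`d/dt [3 (max (Q−a) 0)² Q'] = 6 max(Q−a) 0 · Q'² + 3 (max (Q−a) 0)² · ΣΣ 2(ψ_w − ψ_w')²`. [folklore] -/
theorem win_dpen_hasDerivAt (φ ψ : W r → ℝ) (a t : ℝ) :
    HasDerivAt (fun s : ℝ =>
        3 * (max ((∑ w, ∑ w', ((φ w + s * ψ w) - (φ w' + s * ψ w')) ^ 2) - a) 0) ^ 2 *
          ∑ w, ∑ w', 2 * ((φ w + s * ψ w) - (φ w' + s * ψ w')) * (ψ w - ψ w'))
      (6 * max ((∑ w, ∑ w', ((φ w + t * ψ w) - (φ w' + t * ψ w')) ^ 2) - a) 0 *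
          (∑ w, ∑ w', 2 * ((φ w + t * ψ w) - (φ w' + t * ψ w')) * (ψ w - ψ w')) ^ 2 +
        3 * (max ((∑ w, ∑ w', ((φ w + t * ψ w) - (φ w' + t * ψ w')) ^ 2) - a) 0) ^ 2 *
          ∑ w, ∑ w', 2 * (ψ w - ψ w') ^ 2) t := by
  have hQ := (win_dir_hasDerivAt φ ψ t).sub_const a
  have h1 : HasDerivAt (fun s : ℝ =>
      3 * (max ((∑ w, ∑ w', ((φ w + s * ψ w) - (φ w' + s * ψ w')) ^ 2) - a) 0) ^ 2)
      (6 * max ((∑ w, ∑ w', ((φ w + t * ψ w) - (φ w' + t * ψ w')) ^ 2) - a) 0 *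
        ∑ w, ∑ w', 2 * ((φ w + t * ψ w) - (φ w' + t * ψ w')) * (ψ w - ψ w')) t :=
    (pen_hasDerivAt_sq _).comp t hQ
  have h2 := win_ddir_hasDerivAt φ ψ t
  exact (h1.fun_mul h2).congr_deriv (by ring)

/-- The second derivative of the window penalty is non-negative. [folklore] -/
theorem win_dpen_nonneg (φ ψ : W r → ℝ) (a : ℝ) :
    0 ≤ 6 * max ((∑ w, ∑ w', (φ w - φ w') ^ 2) - a) 0 *
          (∑ w, ∑ w', 2 * (φ w - φ w') * (ψ w - ψ w')) ^ 2 +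
        3 * (max ((∑ w, ∑ w', (φ w - φ w') ^ 2) - a) 0) ^ 2 * ∑ w, ∑ w', 2 * (ψ w - ψ w') ^ 2 := by
  have h0 : 0 ≤ max ((∑ w, ∑ w', (φ w - φ w') ^ 2) - a) 0 := le_max_right _ _
  have h1 : 0 ≤ ∑ w, ∑ w', 2 * (ψ w - ψ w') ^ 2 :=
    Finset.sum_nonneg fun _ _ => Finset.sum_nonneg fun _ _ => by positivity
  positivity

/-- Outside the `2a`-core the window penalty restores curvature:
if `ΣΣ(φ_w − φ_w')² ≥ 2a` (`a ≥ 0`) the second derivative is `≥ 6a²·ΣΣ(ψ_w − ψ_w')²`. [folklore] -/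
theorem win_dpen_ge_of_far (φ ψ : W r → ℝ) {a : ℝ} (ha : 0 ≤ a)
    (hfar : 2 * a ≤ ∑ w, ∑ w', (φ w - φ w') ^ 2) :
    6 * a ^ 2 * ∑ w, ∑ w', (ψ w - ψ w') ^ 2 ≤
      6 * max ((∑ w, ∑ w', (φ w - φ w') ^ 2) - a) 0 *
          (∑ w, ∑ w', 2 * (φ w - φ w') * (ψ w - ψ w')) ^ 2 +
        3 * (max ((∑ w, ∑ w', (φ w - φ w') ^ 2) - a) 0) ^ 2 * ∑ w, ∑ w', 2 * (ψ w - ψ w') ^ 2 := by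
  set m := max ((∑ w, ∑ w', (φ w - φ w') ^ 2) - a) 0 with hm
  have hma : a ≤ m := le_trans (by linarith) (le_max_left _ _)
  have hm0 : 0 ≤ m := le_max_right _ _
  have hD : 0 ≤ ∑ w, ∑ w', (ψ w - ψ w') ^ 2 :=
    Finset.sum_nonneg fun _ _ => Finset.sum_nonneg fun _ _ => sq_nonneg _
  have h2 : ∑ w, ∑ w', 2 * (ψ w - ψ w') ^ 2 = 2 * ∑ w, ∑ w', (ψ w - ψ w') ^ 2 := by
    rw [Finset.mul_sum]; refine Finset.sum_congr rfl fun w _ => ?_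
    rw [Finset.mul_sum]
  rw [h2]
  have hsq : a ^ 2 ≤ m ^ 2 := pow_le_pow_left₀ ha hma 2
  have hfirst : 0 ≤ 6 * m * (∑ w, ∑ w', 2 * (φ w - φ w') * (ψ w - ψ w')) ^ 2 := by positivity
  nlinarith [mul_le_mul_of_nonneg_right hsq hD]

/-! ### The real window Hessian is bounded by the table norm -/

/-- **The real window Hessian is bounded by `2·normA`**: for a (U1) table,
`|Re H_c(φ)ψ| ≤ 2·normA(c)·ΣΣ(ψ_w − ψ_w')²` (from `(n·ψ)² ≤ |n|₁²·ΣΣ(ψ_w − ψ_w')²` and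
`|n|₁² ≤ 2e^{|n|₁}`). [folklore] -/
theorem win_abs_reHess_le (c : Table r) (hU1 : ∀ n ∈ c.support, ∑ w, n w = 0)
    (φ ψ : W r → ℝ) :
    |(-c.sum (fun n a => a * (((∑ w, (n w : ℝ) * ψ w) ^ 2 : ℝ) : ℂ) *
        Complex.exp (Complex.I * ((∑ w, (n w : ℝ) * φ w : ℝ) : ℂ)))).re| ≤
      2 * normA c * ∑ w, ∑ w', (ψ w - ψ w') ^ 2 := by
  classical
  have hDnn : 0 ≤ ∑ w, ∑ w', (ψ w - ψ w') ^ 2 :=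
    Finset.sum_nonneg fun _ _ => Finset.sum_nonneg fun _ _ => sq_nonneg _
  refine (Complex.abs_re_le_norm _).trans ?_
  rw [norm_neg, Finsupp.sum]
  refine (norm_sum_le _ _).trans ?_
  have key : ∀ n ∈ c.support,
      ‖c n * (((∑ w, (n w : ℝ) * ψ w) ^ 2 : ℝ) : ℂ) *
          Complex.exp (Complex.I * ((∑ w, (n w : ℝ) * φ w : ℝ) : ℂ))‖ ≤
        ‖c n‖ * Real.exp (∑ w, |(n w : ℝ)|) * (2 * ∑ w, ∑ w', (ψ w - ψ w') ^ 2) := by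
    intro n hn
    have hfrq := cvxr_frq_sq_le n (hU1 n hn) ψ
    have hexp : (∑ w, |(n w : ℝ)|) ^ 2 ≤ 2 * Real.exp (∑ w, |(n w : ℝ)|) := by
      -- `x² ≤ 2eˣ` for `x ≥ 0`
      have hx : (0 : ℝ) ≤ ∑ w, |(n w : ℝ)| := Finset.sum_nonneg fun w _ => abs_nonneg _
      have h := Real.pow_div_factorial_le_exp _ hx 2
      rw [show (Nat.factorial 2 : ℝ) = 2 by norm_num, div_le_iff₀ (by norm_num : (0:ℝ) < 2)] at h
      linarith
    rw [norm_mul, norm_mul, Complex.norm_exp_I_mul_ofReal, mul_one, Complex.norm_real,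
      Real.norm_eq_abs, abs_of_nonneg (sq_nonneg _)]
    calc ‖c n‖ * (∑ w, (n w : ℝ) * ψ w) ^ 2
        ≤ ‖c n‖ * ((∑ w, |(n w : ℝ)|) ^ 2 * ∑ w, ∑ w', (ψ w - ψ w') ^ 2) :=
          mul_le_mul_of_nonneg_left hfrq (norm_nonneg _)
      _ ≤ ‖c n‖ * ((2 * Real.exp (∑ w, |(n w : ℝ)|)) * ∑ w, ∑ w', (ψ w - ψ w') ^ 2) :=
          mul_le_mul_of_nonneg_left (mul_le_mul_of_nonneg_right hexp hDnn) (norm_nonneg _)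
      _ = ‖c n‖ * Real.exp (∑ w, |(n w : ℝ)|) * (2 * ∑ w, ∑ w', (ψ w - ψ w') ^ 2) := by ring
  refine (Finset.sum_le_sum key).trans ?_
  rw [← Finset.sum_mul]
  unfold normA
  rw [Finsupp.sum]
  apply le_of_eq
  ring

/-! ### The penalised window floor -/

/-- Small Dirichlet form ⇒ small oscillation: `ΣΣ(φ_w − φ_w')² ≤ δ²` gives `|φ_w − φ_w'| ≤ δ`. [folklore] -/
theorem win_osc_le_of_dir_le (φ : W r → ℝ) {δ : ℝ} (hδ : 0 ≤ δ)
    (h : ∑ w, ∑ w', (φ w - φ w') ^ 2 ≤ δ ^ 2) (w w' : W r) : |φ w - φ w'| ≤ δ :=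
  abs_le_of_sq_le_sq ((cvxr_sq_sub_le_dir φ w w').trans h) hδ

/-- **The penalised window floor.**  Let the table satisfy (U1) and `normA c ≤ B`, and let `δ₀`
be a convexity radius for it (`(c₀/4)·ΣΣ(ψ_w−ψ_w')² ≤ Re H_c(φ)ψ` whenever `osc φ ≤ δ₀`).  With the
core threshold `a = δ₀²/2` and any penalty strength `k ≥ 0` with `k·6a² ≥ 2max(B,0) + c₀/4`, the
real window Hessian plus `k` times the penalty's second derivative is bounded below by
`(c₀/4)·ΣΣ(ψ_w − ψ_w')²` at EVERY window configuration. [folklore] -/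
theorem win_floor (c : Table r) (hU1 : ∀ n ∈ c.support, ∑ w, n w = 0) {B c₀ δ₀ a k : ℝ}
    (hA : normA c ≤ B) (hδ₀ : 0 < δ₀)
    (hconv : ∀ φ : W r → ℝ, (∀ w w', |φ w - φ w'| ≤ δ₀) → ∀ ψ : W r → ℝ,
      c₀ / 4 * ∑ w, ∑ w', (ψ w - ψ w') ^ 2 ≤
        (-c.sum (fun n a => a * (((∑ w, (n w : ℝ) * ψ w) ^ 2 : ℝ) : ℂ) *
          Complex.exp (Complex.I * ((∑ w, (n w : ℝ) * φ w : ℝ) : ℂ)))).re)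
    (ha : 2 * a = δ₀ ^ 2) (hk0 : 0 ≤ k) (hk : 2 * max B 0 + c₀ / 4 ≤ k * (6 * a ^ 2))
    (φ ψ : W r → ℝ) :
    c₀ / 4 * ∑ w, ∑ w', (ψ w - ψ w') ^ 2 ≤
      (-c.sum (fun n a => a * (((∑ w, (n w : ℝ) * ψ w) ^ 2 : ℝ) : ℂ) *
          Complex.exp (Complex.I * ((∑ w, (n w : ℝ) * φ w : ℝ) : ℂ)))).re +
        k * (6 * max ((∑ w, ∑ w', (φ w - φ w') ^ 2) - a) 0 *
              (∑ w, ∑ w', 2 * (φ w - φ w') * (ψ w - ψ w')) ^ 2 +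
            3 * (max ((∑ w, ∑ w', (φ w - φ w') ^ 2) - a) 0) ^ 2 *
              ∑ w, ∑ w', 2 * (ψ w - ψ w') ^ 2) := by
  have ha0 : 0 ≤ a := by nlinarith [sq_nonneg δ₀]
  set D := ∑ w, ∑ w', (ψ w - ψ w') ^ 2 with hD
  have hDnn : 0 ≤ D := Finset.sum_nonneg fun _ _ => Finset.sum_nonneg fun _ _ => sq_nonneg _
  have hpen0 := win_dpen_nonneg φ ψ a
  by_cases hcore : ∑ w, ∑ w', (φ w - φ w') ^ 2 ≤ 2 * a
  · -- inside the `2a`-core: convexity radius, penalty curvature ≥ 0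
    have hosc : ∀ w w', |φ w - φ w'| ≤ δ₀ :=
      win_osc_le_of_dir_le φ hδ₀.le (by rw [← ha]; exact hcore)
    have h1 := hconv φ hosc ψ
    nlinarith [mul_nonneg hk0 hpen0]
  · -- outside: the penalty restores the floor, the real Hessian is `≥ -2 max(B,0)·D`
    have hfar := win_dpen_ge_of_far φ ψ ha0 (not_le.1 hcore).le
    have habs := win_abs_reHess_le c hU1 φ ψ
    have hnA : normA c ≤ max B 0 := hA.trans (le_max_left _ _)
    have hlow : -(2 * max B 0 * D) ≤
        (-c.sum (fun n a => a * (((∑ w, (n w : ℝ) * ψ w) ^ 2 : ℝ) : ℂ) *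
          Complex.exp (Complex.I * ((∑ w, (n w : ℝ) * φ w : ℝ) : ℂ)))).re := by
      have h1 := (abs_le.1 habs).1
      have h2 : 2 * normA c * D ≤ 2 * max B 0 * D :=
        mul_le_mul_of_nonneg_right (by linarith) hDnn
      linarith
    have hk' : (2 * max B 0 + c₀ / 4) * D ≤ k * (6 * a ^ 2 * D) := by
      have := mul_le_mul_of_nonneg_right hk hDnn
      linarith [this]
    nlinarith [mul_le_mul_of_nonneg_left hfar hk0]

end CorePenalty

end Summit.HubbardSuperconductivity.HubbardSuperconductivity.Theorems
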